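import Summits.QuantumFields.YangMills.Theorems.BalabanUVNodesN22Knit

/-!
# BalabanUVNodes ∕ N22 knit, ANALYTIC BRANCH — the regularity clause (R) of `BalabanUVNodesN22Knit` from COMPLEX ANALYTICITY of the
# young-coupling sections with a uniform margin around `[0, γ]` (the printed «(or analytic)» branch, [Balaban1987RG1] p. 263 ∕ p. 266, in
# pv10's `CouplingAnalytic` currency extended to the closed interval), by two Cauchy estimates (Track A, DAG node N22 = NE9; cluster K4)

HONEST FRAMING.  Count-neutral kernel bookkeeping over hypothesis shapes on abstract carriers; NOT a node discharge; NE5 ∕ NE9 NOT IN PRINT,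
NOT PROVED; instance on Bałaban's `E^{(j)}` 0∕1; one finite four-torus programme at fixed ε; nothing continuum ∕ ℝ⁴ ∕ OS ∕ mass-gap ∕ Clay.
0 `sorry`, 0 `def`, standard axioms.  Filed `--supports` item `SpineGivenEndpoint` (route «BalabanUVNodes», cluster K4).

WHAT.  `BalabanUVNodesN22Knit.ne9_and_fadingMemory_of_osc_smooth` derives node N22's statement of record from (P) prefix dependence, (O)
oscillation fading (= tower-NE5) and (R) = C^{1,1} regularity of each young-coupling section `t ↦ E (update g i t) U X` on `[0, γ]` with ONE
constant `M·e^{−κd(X)}`.  Print offers two TYPES for the last coupling ([Balaban1987RG1] p. 263): *"It is a C^∞-function of g_{j−1} ∈ [0, γ],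
(or analytic)"*.  The C^∞ ∕ C² type is `…N22Knit.ne9_and_fadingMemory_of_osc_derivTwo`; THIS FILE serves the ANALYTIC type:
* §1 `hasDeriv_lipschitzDeriv_of_analytic_margin` — ONE REAL VARIABLE: if `f : ℝ → ℝ` agrees on `[0, γ]` with a complex-analytic `F` on a set
  `D ⊆ ℂ` containing the closed discs of radius `r > 0` about every point of `[0, γ]`, `‖F‖ ≤ B` on `D`, then `f` is differentiable within
  `[0, γ]` with derivative `Re F′` and `Re F′` is `(32B∕r²)`-Lipschitz on `[0, γ]` — Cauchy's estimate for `F′` on the discs of radius `r∕2`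
  (`Complex.norm_deriv_le_of_forall_mem_sphere_norm_le`), then [Dimock2015]'s real-parameter Lipschitz lemma `real_param_lipschitz` for `F′`
  with margin `r∕4`.
* §2 `smooth_of_couplingAnalyticIcc` — on the abstract carriers: COORDINATE-DISC ANALYTICITY WITH A UNIFORM MARGIN `r` AROUND THE CLOSED
  INTERVAL (`CouplingAnalytic`'s shape of pv10 with `Icc` in place of `Ioc`, bound `M·e^{−κd(X)}`) ⟹ the knit's clause (R) with the constant
  `(32M∕r²)·e^{−κd(X)}`.  (pv10's own verdict stands: in Bałaban's printed scheme (2.9) no g-INDEPENDENT radius is available near the vertex —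
  `T4CouplingAnalyticity` (W1)∕(L2), `exists_couplingAnalyticRel_not_ne9Window` —, so this branch is the p. 266 alternative cut-off's type, not
  (2.9)'s; recorded for completeness of the printed disjunction.)
* §3 `ne9_and_fadingMemory_of_osc_analytic` — (P) ∧ (O) ∧ uniform-margin analyticity ⟹ `NE9 E (Window γ) κ Λ₁ ∧ FadingMemory C₉ τ Λ₁`,
  `C₉ = (2C₀∕γ + 16Mγ∕r²)∕τ`, `θ ≤ τ²` (the knit's headline with (R) from §2) — upgrading pv10's `ne9_of_couplingAnalytic` (moduli `4M∕r`, NO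
  decay) to FADING moduli given the tower rate.

References (TYPES only): [Balaban1987RG1] = T. Bałaban, Commun. Math. Phys. **109** (1987) 249–301, p. 263, p. 266; [Dimock2015] = J. Dimock,
*The renormalization group according to Bałaban III*, the Cauchy-estimate Lipschitz lemma as typed in `Literature/…/Dimock2015/AnalyticLipschitz`.
-/

noncomputable section

namespace Summit.QuantumFields.YangMills.BalabanUVNodes.N22KnitAnalytic

open Set Metric Complex
open Literature.MathematicalPhysics.QuantumFieldTheory.Balaban1983to89
open Literature.MathematicalPhysics.QuantumFieldTheory.Balaban1983to89.T4OutputRate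
open Literature.MathematicalPhysics.QuantumFieldTheory.Dimock2015 (real_param_lipschitz)

/-! ## §1 One real variable: analytic with a margin around `[0, γ]` ⇒ C^{1,1} on `[0, γ]` -/

/-- **CAUCHY ⇒ C^{1,1} ON THE CLOSED INTERVAL.**  `F` complex-differentiable on `D`, `‖F‖ ≤ B` on `D`, the closed discs of radius `r > 0`
about the points of `[0, γ]` inside `D`, and `F = f` on `[0, γ]`: then `f` has derivative `Re F′` within `[0, γ]` and `Re F′` is
`(32B∕r²)`-Lipschitz there (Cauchy's estimate `‖F′‖ ≤ 2B∕r` on the `r∕2`-neighbourhood of `[0, γ]`, then `real_param_lipschitz` for `F′` with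
margin `r∕4`). [folklore] -/
theorem hasDeriv_lipschitzDeriv_of_analytic_margin {F : ℂ → ℂ} {D : Set ℂ} {f : ℝ → ℝ} {γ r B : ℝ} (hr : 0 < r)
    (hF : DifferentiableOn ℂ F D) (hB : ∀ z ∈ D, ‖F z‖ ≤ B)
    (hD : ∀ s ∈ Icc (0 : ℝ) γ, closedBall (s : ℂ) r ⊆ D) (hf : ∀ s ∈ Icc (0 : ℝ) γ, F s = f s) :
    (∀ t ∈ Icc (0 : ℝ) γ, HasDerivWithinAt f ((deriv F t).re) (Icc (0 : ℝ) γ) t) ∧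
    ∀ s ∈ Icc (0 : ℝ) γ, ∀ t ∈ Icc (0 : ℝ) γ, |(deriv F s).re - (deriv F t).re| ≤ 32 * B / r ^ 2 * |s - t| := by
  -- the open `r/2`-neighbourhood of `[0, γ]`, inside `D`
  set Dg : Set ℂ := ⋃ s ∈ Icc (0 : ℝ) γ, ball (s : ℂ) (r / 2) with hDg
  have hDg_open : IsOpen Dg := isOpen_biUnion fun _ _ => isOpen_ball
  have hDg_sub : Dg ⊆ D := by
    intro z hz
    obtain ⟨s, hs, hzs⟩ := mem_iUnion₂.mp hz
    refine hD s hs ?_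
    rw [mem_ball] at hzs
    rw [mem_closedBall]
    linarith
  -- `F′` is complex-differentiable there and bounded by `2B/r` (Cauchy on the discs of radius `r/2`)
  have hderivF : DifferentiableOn ℂ (deriv F) Dg :=
    ((hF.mono hDg_sub).analyticOnNhd hDg_open).deriv.differentiableOn
  have hbound : ∀ z ∈ Dg, ‖deriv F z‖ ≤ 2 * B / r := by
    intro z hz
    obtain ⟨s, hs, hzs⟩ := mem_iUnion₂.mp hz
    rw [mem_ball] at hzs
    have hsub : closedBall z (r / 2) ⊆ D := by
      refine Subset.trans (fun w hw => ?_) (hD s hs)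
      rw [mem_closedBall] at hw ⊢
      linarith [dist_triangle w z (s : ℂ)]
    have key := Complex.norm_deriv_le_of_forall_mem_sphere_norm_le (half_pos hr) (hF.diffContOnCl_ball hsub)
      (fun w hw => hB w (hsub (sphere_subset_closedBall hw)))
    calc ‖deriv F z‖ ≤ B / (r / 2) := key
      _ = 2 * B / r := by rw [div_div_eq_mul_div]; ring
  have hmargin : ∀ s ∈ Icc (0 : ℝ) γ, closedBall (s : ℂ) (r / 4) ⊆ Dg := by
    intro s hs z hz
    refine mem_iUnion₂.mpr ⟨s, hs, ?_⟩
    rw [mem_closedBall] at hz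
    rw [mem_ball]
    linarith
  refine ⟨fun t ht => ?_, fun s hs t ht => ?_⟩
  · -- the real section has derivative `Re F′(t)` (within `[0, γ]`)
    have hDt : D ∈ nhds (t : ℂ) :=
      mem_nhds_iff.mpr ⟨ball (t : ℂ) r, ball_subset_closedBall.trans (hD t ht), isOpen_ball, mem_ball_self hr⟩
    have h1 : HasDerivAt F (deriv F t) (t : ℂ) := (hF.differentiableAt hDt).hasDerivAt
    have h2 : HasDerivAt (fun x : ℝ => (F x).re) (deriv F t).re t := h1.real_of_complex
    refine h2.hasDerivWithinAt.congr (fun x hx => ?_) ?_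
    · rw [hf x hx, Complex.ofReal_re]
    · rw [hf t ht, Complex.ofReal_re]
  · -- `Re F′` is Lipschitz: Dimock's real-parameter Cauchy lemma for `F′` with margin `r/4`
    have hL := real_param_lipschitz (a := 0) (b := γ) (by positivity : 0 < r / 4) hderivF hbound hmargin hs ht
    calc |(deriv F s).re - (deriv F t).re| = |(deriv F s - deriv F t).re| := by rw [Complex.sub_re]
      _ ≤ ‖deriv F s - deriv F t‖ := Complex.abs_re_le_norm _
      _ ≤ 4 * (2 * B / r) / (r / 4) * |s - t| := hL
      _ = 32 * B / r ^ 2 * |s - t| := by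
          congr 1
          field_simp
          ring

/-! ## §2 On the carriers: uniform-margin coordinate analyticity around `[0, γ]` ⇒ the knit's regularity clause (R) -/

/-- **COORDINATE-DISC ANALYTICITY WITH A UNIFORM MARGIN ⇒ (R).**  If for every admissible history `g`, background `U`, domain `X` and coupling
`i < scale X` the section `s ↦ E (update g i s) U X` on `[0, γ]` extends to a complex-analytic `F` on a set containing the closed discs of
radius `r > 0` about `[0, γ]`, with `‖F‖ ≤ M·e^{−κd(X)}` there (pv10's `CouplingAnalytic` shape on the closed interval), then the knit's clause
(R) holds with the C^{1,1} constant `(32M∕r²)·e^{−κd(X)}`. [folklore] -/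
theorem smooth_of_couplingAnalyticIcc {C : Carriers} {Bg : Type} {E : Functional C Bg} {γ κ M r : ℝ} (hr : 0 < r)
    (hA : ∀ g ∈ Window γ, ∀ (U : Bg) (X : C.Dom) (i : ℕ), i < C.scale X → ∃ (F : ℂ → ℂ) (D : Set ℂ),
      DifferentiableOn ℂ F D ∧ (∀ z ∈ D, ‖F z‖ ≤ M * Real.exp (-(κ * C.d X))) ∧
      (∀ s ∈ Icc (0 : ℝ) γ, closedBall (s : ℂ) r ⊆ D) ∧ (∀ s ∈ Icc (0 : ℝ) γ, F s = (E (Function.update g i s) U X : ℂ))) :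
    ∀ g ∈ Window γ, ∀ (U : Bg) (X : C.Dom) (i : ℕ), i < C.scale X → ∃ f' : ℝ → ℝ,
      (∀ t ∈ Icc (0 : ℝ) γ, HasDerivWithinAt (fun t : ℝ => E (Function.update g i t) U X) (f' t) (Icc (0 : ℝ) γ) t) ∧
      ∀ s ∈ Icc (0 : ℝ) γ, ∀ t ∈ Icc (0 : ℝ) γ, |f' s - f' t| ≤ 32 * M / r ^ 2 * Real.exp (-(κ * C.d X)) * |s - t| := by
  intro g hg U X i hi
  obtain ⟨F, D, hF, hB, hD, hf⟩ := hA g hg U X i hi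
  obtain ⟨hd, hL⟩ :=
    hasDeriv_lipschitzDeriv_of_analytic_margin (f := fun t : ℝ => E (Function.update g i t) U X) hr hF hB hD hf
  exact ⟨fun t => (deriv F t).re, hd, fun s hs t ht => (hL s hs t ht).trans (le_of_eq (by ring))⟩

/-! ## §3 Node N22 from (P) + (O) + uniform-margin analyticity -/

/-- **NODE N22 FROM OSCILLATION FADING + THE ANALYTIC BRANCH.**  (P) prefix dependence, (O) oscillation fading (`C₀ ≥ 0`, rate `θ ≥ 0`;
= tower-NE5) and coordinate-disc analyticity of the young-coupling sections with a uniform margin `r > 0` around `[0, γ]` and bound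
`M·e^{−κd(X)}` (`M ≥ 0`) give, for every `τ ∈ ]0, 1]` with `θ ≤ τ²`, **`NE9 E (Window γ) κ Λ₁ ∧ FadingMemory C₉ τ Λ₁`** with
`Λ₁ k i = C₉·τ^{k−i}`, `C₉ = (2C₀∕γ + (32M∕r²)·γ∕2)∕τ` — `N22Knit.ne9_and_fadingMemory_of_osc_smooth` with (R) supplied by §2. [folklore] -/
theorem ne9_and_fadingMemory_of_osc_analytic {C : Carriers} {Bg : Type} {E : Functional C Bg} {γ κ C₀ θ M r τ : ℝ}
    (hP : PrefixDependenceOn E (Window γ))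
    (hO : ∀ g ∈ Window γ, ∀ g' ∈ Window γ, ∀ (U : Bg) (X : C.Dom) (a : ℕ), a ≤ C.scale X →
      (∀ n, a ≤ n → g n = g' n) → |E g U X - E g' U X| ≤ C₀ * θ ^ (C.scale X - a) * Real.exp (-(κ * C.d X)))
    (hA : ∀ g ∈ Window γ, ∀ (U : Bg) (X : C.Dom) (i : ℕ), i < C.scale X → ∃ (F : ℂ → ℂ) (D : Set ℂ),
      DifferentiableOn ℂ F D ∧ (∀ z ∈ D, ‖F z‖ ≤ M * Real.exp (-(κ * C.d X))) ∧
      (∀ s ∈ Icc (0 : ℝ) γ, closedBall (s : ℂ) r ⊆ D) ∧ (∀ s ∈ Icc (0 : ℝ) γ, F s = (E (Function.update g i s) U X : ℂ)))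
    (hC₀ : 0 ≤ C₀) (hθ0 : 0 ≤ θ) (hM : 0 ≤ M) (hr : 0 < r) (hγ : 0 < γ) (hτ0 : 0 < τ) (hτ1 : τ ≤ 1) (hθτ : θ ≤ τ ^ 2) :
    NE9 E (Window γ) κ (fun k i => (2 * C₀ / γ + 32 * M / r ^ 2 * γ / 2) / τ * τ ^ (k - i)) ∧
      FadingMemory ((2 * C₀ / γ + 32 * M / r ^ 2 * γ / 2) / τ) τ
        (fun k i => (2 * C₀ / γ + 32 * M / r ^ 2 * γ / 2) / τ * τ ^ (k - i)) :=
  N22Knit.ne9_and_fadingMemory_of_osc_smooth hP hO (smooth_of_couplingAnalyticIcc hr hA) hC₀ hθ0 (by positivity) hγ hτ0 hτ1 hθτ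

end Summit.QuantumFields.YangMills.BalabanUVNodes.N22KnitAnalytic

end
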